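import Summits.Ventures.PercRepro.RankDistBookSum
import Summits.Ventures.PercRepro.RankDistBottomCumulative

/-!
# PercRepro — C-025 HOLDS ON THE (SC)-COUNTEREXAMPLE `B_11 ⊕ B_12` (p9, gen 23)

The row (SC) fails on `B_11 ⊕ B_12` (`not_shadowCumulative_bookSum`), but the repaired row (BC) holds on every
book (`bottomCumulativeTop_book`) and is closed under direct sums (`bottomCumulativeTop_disjointSum`), so
**`rls_bookSum`: the crux C-025 `ThmN.RLS` holds on `B_11 ⊕ B_12` at `(25, 23)`** — the counterexample to the
strengthening is no counterexample to the crux. Nothing here moves any window of the crux.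
-/

namespace PercRepro.RankDist

open Set Finset _root_.Matroid PercRepro.ThmH

/-- `B_11 ⊕ B_12` satisfies (BC) at `(25, 23)`. -/
theorem bottomCumulativeTop_bookSum [hS : bookSum.Finite] : BottomCumulativeTop bookSum 25 23 :=
  bottomCumulativeTop_disjointSum bookL bookR disjoint_bookL_bookR bookL_data.1 bookL_data.2 bookR_data.1
    bookR_data.2 (by norm_num) (by norm_num) (bottomCumulativeTop_book _ Sum.inl_injective)
    (bottomCumulativeTop_book _ Sum.inr_injective)

/-- **C-025 holds on `B_11 ⊕ B_12`** (where the row (SC) fails). -/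
theorem rls_bookSum [hS : bookSum.Finite] : ThmN.RLS bookSum 25 23 :=
  rls_of_bottomCumulativeTop _ _ _ bottomCumulativeTop_bookSum

/-- **C-025 on `B_11 ⊕ B_12`, with its finiteness instance supplied.** -/
theorem rls_bookSum' : @ThmN.RLS BookSumIx bookSum bookSum_finite 25 23 :=
  @rls_bookSum bookSum_finite

end PercRepro.RankDist
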